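import Summits.QuantumAdvantage.QuantumAdvantage.Theorems.CubicForrelationNearExactIsExactTwelveT1Dead

/-!
# Crux `CubicForrelation.NearExactIsExact` (stmt-QuantumAdvantage-14043) — n = 12, type O with base set `960` at `Φ ≥ 931/1024`: no wild point
  survives, so the side sits at `932/1024` — where it is already dead (`tw19_isolation_ge_932`)

Certificate seat `b2b-cforr-cert` (gen 19).  HONEST FRAMING: a kernel-checked lemma (standard axioms) closing the `960`-configuration of the
type-O branch on the rung `931/1024` at `n = 12`; by itself NO new value of `θ₁₂` (the level-`≥ 6` pairs of the window remain).  NOT summit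
progress.

`to19_typeO_E960_ge931_false`: cubic `f, g` on 12 bits, `W_g = 16u`, some `u(x)` odd, base set `#E = 960`, `Φ(f,g) ≥ 931/1024` — impossible.
Proof.  Budget: `Σ τ² = 2¹⁷(1 − Φ) ≤ 11904 = 4096 + 8·960 + 128`, so the wild function `v` (`τ = τ₀ + 8v`, `X ≥ 16v²`) has `Σ v² ≤ 8`.
The partner identity (`to18_typeO_partner_identity`) with `Ê ∈ 64ℤ` (`to18_char_sum_E960`) reads `v̂(y) = 8·K(y)` with
`K(y) = 4(−1)^{g(y)} − 64 s_b [y = c₁] + 4 s_b m(y) − u_f(y) ≡ −u_f(y) (mod 4)`, and `|v̂(y)| ≤ Σ|v| ≤ Σ v² ≤ 8` gives `K(y) ∈ {0, ±1}`.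
If `v ≡ 0` then `Σ τ² = 11776`, `Φ = 932/1024`, contradicting `tw19_isolation_ge_932` (`Φ ≥ 932/1024 ⇒ Φ = 1`).  Otherwise some `v̂(y₀) ≠ 0`
(Parseval), `K(y₀) = ±1`, `u_f(y₀)` is odd, so `f` is type O and EVERY `u_f(y)` is odd (`TypeOTwelve.typeO_of_exists_odd`), every `K(y) = ±1`,
`Σ v̂² = 64·4096`, `Σ v² = 64 > 8`.  With `…TwelveTypeO931Shape` (base set `960` is forced on the rung) this CLOSES THE TYPE-O BRANCH of the rung
`931/1024`: a cubic pair with `931/1024 ≤ Φ < 932/1024` has no type-O side.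

References: Kasami–Tokura (1970); MacWilliams–Sloane (1977) Ch. 15; O'Donnell (2014) §1.4.  Axioms: the standard three.
-/

set_option linter.dupNamespace false -- D-0017: single-problem summit ⇒ `QuantumAdvantage.QuantumAdvantage` by design

noncomputable section

namespace Summit.QuantumAdvantage.QuantumAdvantage.Theorems.CubicForrelation.NearExactIsExact

open Finset
open Literature.Computability.QuantumComplexity
open Literature.Computability.QuantumComplexity.BuzetChailloux (bxor zeroVec bxor_bxor_cancel_left bxor_zeroVec zeroVec_bxor bxor_comm
  bxor_self twist_zeroVec_right twist_bxor_right)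
open Literature.Computability.QuantumComplexity.DerivativeWalsh (W sum_W_sq)
open Literature.Computability.QuantumComplexity.Simon (twist_eq_one_or)
open Summit.QuantumAdvantage.QuantumAdvantage.Theorems.NearExactIsExact.Negative (TypeOTwelve.typeO_of_exists_odd)

/-- **No type-O side with base set `960` at `Φ ≥ 931/1024`** (12 bits; given the partner's Ax-level data `W_f = 16u_f`).  See the module
docstring.  NOT summit progress. [this work] -/
theorem to19_typeO_E960_ge931_false (f g : (Fin (6 + 6) → Bool) → Bool) (hf : IsDegLeFun 3 f) (hg : IsDegLeFun 3 g)
    (u : (Fin (6 + 6) → Bool) → ℤ) (hu : ∀ x, W (fun y => signOf (g y)) x = (2 : ℝ) ^ 4 * (u x : ℝ))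
    (hodd : ∃ x, Odd (u x)) (hE : #(univ.filter fun x : Fin (6 + 6) → Bool => (Odd (u x / 2) ↔ Odd (u x / 2 / 2))) = 960)
    (hΦ : (931 / 1024 : ℝ) ≤ forrelation f g)
    (uf : (Fin (6 + 6) → Bool) → ℤ) (huf : ∀ y, W (fun x => signOf (f x)) y = (2 : ℝ) ^ 4 * (uf y : ℝ)) : False := by
  classical
  have hall : ∀ x, Odd (u x) := TypeOTwelve.typeO_of_exists_odd g u hg hu hodd
  have hu' : ∀ x, W (fun y => signOf (g y)) x = (2 : ℝ) ^ (2 * 2) * (u x : ℝ) := fun x => (hu x).trans (by norm_num)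
  have hd1 : IsDegLeFun 1 (fun x => decide (Odd (u x / 2))) := z2_digitOne 2 g u hg hu' hall
  have hd2 : IsDegLeFun 3 (fun x => decide (Odd (u x / 2 / 2))) := z2_digitTwo 2 g u hg hu' hall
  obtain ⟨c₁, b₁, hcb⟩ := stub_affineForm (6 + 6) _ hd1
  set E := univ.filter (fun x : Fin (6 + 6) → Bool => (Odd (u x / 2) ↔ Odd (u x / 2 / 2))) with hEdef
  have hdegE : IsDegLeFun (2 + 1) (fun x => (decide (Odd (u x / 2)) ^^ decide (Odd (u x / 2 / 2))) ^^ true) :=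
    tb_isDegLeFun_xor_const (bb_isDegLeFun_bxor (hd1.mono (by norm_num)) hd2) true
  have hsetE : (univ.filter fun x : Fin (6 + 6) → Bool =>
      ((decide (Odd (u x / 2)) ^^ decide (Odd (u x / 2 / 2))) ^^ true) = true) = E := by
    rw [hEdef]
    apply filter_congr
    intro x _
    by_cases h1 : Odd (u x / 2) <;> by_cases h2 : Odd (u x / 2 / 2) <;> simp [h1, h2]
  have hsumE : (∑ x, (if (Odd (u x / 2) ↔ Odd (u x / 2 / 2)) then 1 else 0 : ℤ)) = #E := by rw [sum_boole]
  -- budget and the wild function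
  have hbud := tw12_budget f g u hu
  have hT : (∑ x, (u x - 4 * sZ (f x)) ^ 2 : ℤ) ≤ 11904 := by
    have h' : ((∑ x, (u x - 4 * sZ (f x)) ^ 2 : ℤ) : ℝ) ≤ 11904 := by rw [hbud]; linarith
    exact_mod_cast h'
  choose v hv using fun x => to12_pt_mod8 (u x) (sZ (f x)) (hall x) (tp_sZ_cases (f x))
  set τ₀ : (Fin (6 + 6) → Bool) → ℤ := fun x =>
    sZ (decide (Odd (u x / 2))) * (1 - 4 * (if (Odd (u x / 2) ↔ Odd (u x / 2 / 2)) then 1 else 0)) with hτ₀def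
  have hvx : ∀ x, u x - 4 * sZ (f x) = τ₀ x + 8 * v x := fun x => hv x
  have hτ₀val : ∀ x, τ₀ x = 1 ∨ τ₀ x = -1 ∨ τ₀ x = 3 ∨ τ₀ x = -3 := by
    intro x
    simp only [τ₀]
    rcases tp_sZ_cases (decide (Odd (u x / 2))) with h | h <;> rw [h] <;> split_ifs <;> norm_num
  have hτ₀sq : ∀ x, τ₀ x ^ 2 = 1 + 8 * (if (Odd (u x / 2) ↔ Odd (u x / 2 / 2)) then 1 else 0 : ℤ) := by
    intro x
    simp only [τ₀]
    rcases tp_sZ_cases (decide (Odd (u x / 2))) with h | h <;> rw [h] <;> split_ifs <;> norm_num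
  have hsumτ₀ : ∑ x, τ₀ x ^ 2 = 11776 := by
    rw [sum_congr rfl fun x _ => hτ₀sq x, sum_add_distrib, ← mul_sum, hsumE, sum_const, card_univ, Fintype.card_fun,
      Fintype.card_bool, Fintype.card_fin]
    change (4096 : ℕ) • (1 : ℤ) + 8 * ((#E : ℕ) : ℤ) = 11776
    rw [hE]; norm_num
  -- `X ≥ 16 v²` pointwise, hence `Σ v² ≤ 8`
  have hX16 : ∀ x, 16 * v x ^ 2 ≤ (τ₀ x + 8 * v x) ^ 2 - τ₀ x ^ 2 := by
    intro x
    have hv3 : v x = 0 ∨ 1 ≤ v x ∨ v x ≤ -1 := by omega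
    rcases hv3 with h0 | h1 | h1
    · rw [h0]; ring_nf; rfl
    · rcases hτ₀val x with h | h | h | h <;> rw [h] <;> nlinarith
    · rcases hτ₀val x with h | h | h | h <;> rw [h] <;> nlinarith
  have hTdec : (∑ x, (u x - 4 * sZ (f x)) ^ 2 : ℤ) = ∑ x, τ₀ x ^ 2 + ∑ x, ((τ₀ x + 8 * v x) ^ 2 - τ₀ x ^ 2) := by
    rw [← sum_add_distrib]
    exact sum_congr rfl fun x _ => by rw [hvx x]; ring
  have hv2 : ∑ x, v x ^ 2 ≤ 8 := by
    have h1 : 16 * ∑ x, v x ^ 2 ≤ ∑ x, ((τ₀ x + 8 * v x) ^ 2 - τ₀ x ^ 2) := by rw [mul_sum]; exact sum_le_sum fun x _ => hX16 x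
    rw [hTdec, hsumτ₀] at hT
    linarith
  -- `v ≢ 0` (else `Φ = 932/1024`, dead by `tw19_isolation_ge_932`)
  have hvne : ∃ x, v x ≠ 0 := by
    by_contra hnone
    push Not at hnone
    have hT0 : (∑ x, (u x - 4 * sZ (f x)) ^ 2 : ℤ) = 11776 := by
      rw [hTdec, hsumτ₀, sum_eq_zero fun x _ => by rw [hnone x]; ring]; ring
    have hΦ932 : forrelation f g = 932 / 1024 := by
      have : ((11776 : ℤ) : ℝ) = (2 : ℝ) ^ 17 * (1 - forrelation f g) := by rw [← hT0]; exact hbud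
      norm_num at this; linarith
    have h1 := tw19_isolation_ge_932 f g hf hg (by rw [hΦ932])
    rw [hΦ932] at h1
    norm_num at h1
  -- Parseval for `v`
  set Vh : (Fin (6 + 6) → Bool) → ℝ := fun y => ∑ x, (v x : ℝ) * twist x y with hVh
  have hParsV : ∑ y, Vh y ^ 2 = 4096 * ((∑ x, v x ^ 2 : ℤ) : ℝ) := by
    have h := sum_W_sq (n := 6 + 6) (fun x => (v x : ℝ))
    unfold W at h
    rw [h]; push_cast; norm_num
  -- `|Vh| ≤ 8`
  have hVle : ∀ y, |Vh y| ≤ 8 := by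
    intro y
    have h1 : |Vh y| ≤ ∑ x, |(v x : ℝ)| := by
      calc |Vh y| ≤ ∑ x, |(v x : ℝ) * twist x y| := abs_sum_le_sum_abs _ _
        _ = ∑ x, |(v x : ℝ)| := sum_congr rfl fun x _ => by
            rw [abs_mul]; rcases twist_eq_one_or x y with h | h <;> rw [h] <;> simp
    have h2 : ∑ x, |(v x : ℝ)| ≤ ∑ x, ((v x : ℝ)) ^ 2 := sum_le_sum fun x _ => by
      rw [← sq_abs]
      rcases eq_or_ne (v x) 0 with h | h
      · rw [h]; simp
      · have : (1 : ℝ) ≤ |(v x : ℝ)| := by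
          rw [← Int.cast_abs]; exact_mod_cast Int.one_le_abs h
        nlinarith
    have h3 : ∑ x, ((v x : ℝ)) ^ 2 ≤ 8 := by
      have : ((∑ x, v x ^ 2 : ℤ) : ℝ) ≤ 8 := by exact_mod_cast hv2
      push_cast at this; exact this
    linarith
  -- the partner identity with `Ê ∈ 64ℤ`: `Vh(y) = 8·K(y)`, `K ≡ −u_f (mod 4)` (indeed `K + u_f ∈ 4ℤ`)
  have hK : ∀ y, ∃ K : ℤ, Vh y = 8 * (K : ℝ) ∧ 4 ∣ K + uf y := by
    intro y
    have h := to18_typeO_partner_identity f g u hu v hv c₁ b₁ hcb uf huf y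
    rw [← hEdef] at h
    obtain ⟨m, -, hm⟩ := to18_char_sum_E960 _ hdegE (by rw [hsetE]; exact hE) (bxor c₁ y)
    rw [hsetE] at hm
    rw [hm] at h
    change 64 * (uf y : ℝ) = 256 * signOf (g y) - signOf b₁ * ((if bxor c₁ y = (fun _ => false) then (2 : ℝ) ^ (6 + 6) else 0) -
      4 * (64 * (m : ℝ))) - 8 * Vh y at h
    have hsb : signOf b₁ = 1 ∨ signOf b₁ = -1 := by cases b₁ <;> simp [signOf]
    by_cases hz : bxor c₁ y = (fun _ => false)
    · rw [if_pos hz] at h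
      refine ⟨4 * sZ (g y) - 64 * sZ b₁ + 4 * sZ b₁ * m - uf y, ?_, ⟨sZ (g y) - 16 * sZ b₁ + sZ b₁ * m, by ring⟩⟩
      push_cast; rw [tp_sZ_cast, tp_sZ_cast]
      rcases hsb with hs | hs <;> rw [hs] at h ⊢ <;> norm_num at h ⊢ <;> linarith
    · rw [if_neg hz] at h
      refine ⟨4 * sZ (g y) + 4 * sZ b₁ * m - uf y, ?_, ⟨sZ (g y) + sZ b₁ * m, by ring⟩⟩
      push_cast; rw [tp_sZ_cast, tp_sZ_cast]
      rcases hsb with hs | hs <;> rw [hs] at h ⊢ <;> norm_num at h ⊢ <;> linarith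
  -- some `Vh(y₀) ≠ 0`
  have hy₀ : ∃ y₀, Vh y₀ ≠ 0 := by
    by_contra hnone
    push Not at hnone
    have h0 : ∑ y, Vh y ^ 2 = 0 := sum_eq_zero fun y _ => by rw [hnone y]; ring
    rw [hParsV] at h0
    obtain ⟨x₀, hx₀⟩ := hvne
    have h1 : (1 : ℤ) ≤ ∑ x, v x ^ 2 := by
      have : v x₀ ^ 2 ≤ ∑ x, v x ^ 2 := single_le_sum (f := fun x => v x ^ 2) (fun x _ => sq_nonneg _) (mem_univ x₀)
      have : 1 ≤ v x₀ ^ 2 := by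
        have : v x₀ ≤ -1 ∨ 1 ≤ v x₀ := by omega
        rcases this with h | h <;> nlinarith
      linarith
    have : (1 : ℝ) ≤ ((∑ x, v x ^ 2 : ℤ) : ℝ) := by exact_mod_cast h1
    linarith
  obtain ⟨y₀, hy₀⟩ := hy₀
  -- there `K(y₀) = ±1`, so `u_f(y₀)` is odd and `f` is type O
  obtain ⟨K₀, hK₀, hK₀4⟩ := hK y₀
  have hK₀ne : K₀ ≠ 0 := by rintro rfl; exact hy₀ (by rw [hK₀]; simp)
  have hK₀abs : |(K₀ : ℝ)| ≤ 1 := by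
    have h := hVle y₀; rw [hK₀, abs_mul, abs_of_pos (by norm_num : (0 : ℝ) < 8)] at h; linarith
  have hK₀one : K₀ = 1 ∨ K₀ = -1 := by
    have h1 : |K₀| ≤ 1 := by
      have h2 : ((|K₀| : ℤ) : ℝ) ≤ 1 := by rw [Int.cast_abs]; exact hK₀abs
      exact_mod_cast h2
    rcases abs_le.1 h1 with ⟨h2, h3⟩
    omega
  have hufodd : Odd (uf y₀) := by
    rw [Int.odd_iff]
    obtain ⟨q, hq⟩ := hK₀4
    rcases hK₀one with h | h <;> rw [h] at hq <;> omega
  have hallf : ∀ y, Odd (uf y) := TypeOTwelve.typeO_of_exists_odd f uf hf huf ⟨y₀, hufodd⟩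
  -- hence every `K(y)` is odd, `|K(y)| = 1`, `Vh(y)² = 64` everywhere, `Σ v² = 64`
  have h64 : ∀ y, Vh y ^ 2 = 64 := by
    intro y
    obtain ⟨K, hKy, hK4⟩ := hK y
    have hKodd : Odd K := by
      have h1 := hallf y
      rw [Int.odd_iff] at h1 ⊢
      obtain ⟨q, hq⟩ := hK4
      omega
    have hKabs : |(K : ℝ)| ≤ 1 := by
      have h := hVle y; rw [hKy, abs_mul, abs_of_pos (by norm_num : (0 : ℝ) < 8)] at h; linarith
    have hK1 : K = 1 ∨ K = -1 := by
      have h1 : |K| ≤ 1 := by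
        have h2 : ((|K| : ℤ) : ℝ) ≤ 1 := by rw [Int.cast_abs]; exact hKabs
        exact_mod_cast h2
      rcases abs_le.1 h1 with ⟨h2, h3⟩
      obtain ⟨j, hj⟩ := hKodd
      omega
    rw [hKy]
    rcases hK1 with h | h <;> rw [h] <;> norm_num
  have hsum : ∑ y, Vh y ^ 2 = 4096 * 64 := by
    rw [sum_congr rfl fun y _ => h64 y, sum_const, card_univ, Fintype.card_fun, Fintype.card_bool, Fintype.card_fin]
    norm_num
  rw [hParsV] at hsum
  have : ((∑ x, v x ^ 2 : ℤ) : ℝ) = 64 := by linarith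
  have : (∑ x, v x ^ 2 : ℤ) = 64 := by exact_mod_cast this
  linarith

/-- **No type-O side with base set `960` at `Φ ≥ 931/1024`**, packaged without the partner's Ax-level data.  NOT summit progress. [this work] -/
theorem to19_typeO_E960_ge931_false' (f g : (Fin (6 + 6) → Bool) → Bool) (hf : IsDegLeFun 3 f) (hg : IsDegLeFun 3 g)
    (u : (Fin (6 + 6) → Bool) → ℤ) (hu : ∀ x, W (fun y => signOf (g y)) x = (2 : ℝ) ^ 4 * (u x : ℝ))
    (hodd : ∃ x, Odd (u x)) (hE : #(univ.filter fun x : Fin (6 + 6) → Bool => (Odd (u x / 2) ↔ Odd (u x / 2 / 2))) = 960)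
    (hΦ : (931 / 1024 : ℝ) ≤ forrelation f g) : False := by
  obtain ⟨uf, huf⟩ := tw_base (n := 6 + 6) f hf 4 (by norm_num)
  exact to19_typeO_E960_ge931_false f g hf hg u hu hodd hE hΦ uf huf

end Summit.QuantumAdvantage.QuantumAdvantage.Theorems.CubicForrelation.NearExactIsExact

end
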